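import Summits.QuantumFields.YangMills.Theorems.BalabanUVNodesK1V9Defs

/-!
# K1⁹ «v10» LINE 2′ (R1W: LINE 2 WINDOW-GUARDED) — THE THREE NEW REGISTERED VW-STUB TEXTS' PREDICATES AS TREE DEFINITIONS (`NodesAtSomeRecord13PWSVW`, `RunRowsAtSomeRecord13PWSVW`,
# `RunRowsContAtSomeRecord13PWSVW`), so that LINE-2′ stub proofs and suppliers can be filed BY NAME; the doors LINE 2 ⟹ LINE 2′ and LINE 1 ⟹ LINE 2′; the rung projections

Cell `ym-nodeO-ideate`, DEFINER seat `ym-nodeO-def-1` (gen 9).  `--kind definition --supports stmt-QuantumFields-27364 --as helper --no-relocate`; count-neutral.  SIBLING of this seat's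
`Thm/BalabanUVNodesK1V9Defs.lean` (p628520: `RecordSV` — UNCHANGED by R1W — and LINE 2's V rungs ∕ doors ∕ composition; IMPORTED here, nothing re-declared) in dag-n24-w1's
`K1V6Defs` ∕ `K1V7RDefs` pattern.  Source of the texts: plan g86's REGISTERED skeleton K1 «v10» `HOME/pub-ymgap-plan/D86-K1V9/r1w/K1Skeleton13SepCoPHv10.lean` (sha16 4b84746c2d4b6041, ns
`…Theses.BalabanUVNodes.K1Skeleton13SepCoPHV10`; director-ym g10 №216 (ii) «v10 = LINE 1 ∪ LINE 2′: GO — ONCE», plan INTENT-V10 pub-ymgap bus l.≈37640, registered on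
stmt-QuantumFields-27364 at the window's end) = the R1W draft `…/r1w/K1Skeleton13SepCoPHv10draft.lean` (fa98b8468a6788c1) with only namespace ∕ header rewritten — the seven rung texts
byte-compared 7∕7 by this seat (bus l.37650); R1W sheet `…/r1w/R1W-SHAPE-SHEET.md` (befbb50c4bf596e3).
[I] = [Balaban1987RG1]; [II] = [Balaban1988RG2Cluster]; [III] = [Balaban1988Convergent]; [V] = [Balaban1989LargeFieldII]; [16] = [Balaban1985UV3]; [IV] = [Balaban1989LargeFieldI].

WHY.  dag-n24-c g11 LOCATED-RUNG1-PIN (pub-ymgap bus l.36525), option (α): the DAG's END reads the thirteen nodes ONLY on runs inside the world's coupling window (`Dag.UVStability4D ℓ :=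
ℓ.smallCouplings → …`, `uvStability_of_nodes`, `endStatementBPrinted_of_worldsP`), so LINE 2's rung 1ⱽ asks the nodes (and the [IV]-pin) on MORE runs than any road reads.  LINE 2′ guards
both by `(leavesP w P).smallCouplings →`; every other conjunct is LINE 2's byte-for-byte (`RecordSV`, unity ∕ slots, admissibility, [B10] by name, the run rows (i)–(iv), (C)).  The VW-predicates
are LOCAL to the skeleton; THIS FILE puts them into the tree BYTE-FOR-BYTE (R1W draft :447 ∕ :454 ∕ :462, byte-identical in v10) with the doors V ⟹ VW (drop the nodes ∕ the pin outside the window; one-liners, = draft :471 ∕ :476 ∕ :481) and LINE 1 ⟹ VW (through `K1V9Defs.…V_of_line1`), and the projections (2ⱽᵂ‴ ⟹ 2ⱽᵂ; 2ⱽᵂ‴ hands `RecordSV` ∧ DEF-1's guard-free θ-level `RunRowsCont13 F θ` — K1⁹'s own rows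
conjunct — at its witness: ONLY the (B)+window half of a composition reads the guard).

NOT IN THIS FILE (one declarer per statement): the W-END road «END + window at the revised datum from the GUARDED nodes and the run letters» (plan's kernel
`endStatementBPrinted_window_of_recordSV_of_nodesW_of_runLetters`; Theorems home = the N13 ∕ N24 lanes by precedent) and the composition «three VW-texts ⟹ K1⁹» over it — a by-name §4 follows as an
append-only edition once that road is in the tree; no stub, no skeleton; LINE 2's texts (`K1V9Defs`), LINE 1's (`K1V6Defs` ∕ `K1V7RDefs`); the LINE-2′ adapters (dag-n24-w1's lane).

CONTENTS (3 `def` + 8 theorems; 0 `sorry`; [folklore] bookkeeping; no `instance`, no `notation`, no `axiom`).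

HONEST FRAMING.  Definitions (registered texts VERBATIM) + binder bookkeeping; NOTHING of Bałaban asserted; NO stub is proved here; nothing registered or re-registered by this seat;
K0⁷ stmt-QuantumFields-20541 ∕ K1⁹ stmt-QuantumFields-27364 (DECIDING) ∕ K3⁸ stmt-QuantumFields-27366 OPEN (K2⁹ 27365 CLOSED `proved`); (B)'s Cor-3 half, (D1) ∕ (D4) ∕ (C) NOT discharged;
counts unmoved (typed 28∕28 · discharged 5∕27 (A 5∕28)).  [I] Thm 2 + (0.31) p. 259 and §1 pp. 263–264 UNPROVED in print; [III] Cor. 3 (2.50)'s pointwise reading NOT proved here.  Route R4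
closes the CONDITIONAL finite-𝕋⁴ rung `BalabanLadder.UV` only — NOT continuum, NOT ℝ⁴, NOT OS, NOT a mass gap, NOT Clay; the Yang–Mills mass gap is NOT proved by any of this.
Sources (context only): [V] Thm 1 p. 355 + (0.1) pp. 355–356; [IV] (1.2) p. 178, Prop. 1 p. 194; [III] (0.2) p. 244, Cor. 3 (2.50) p. 264; [I] Thm 3 p. 264, (5.10) p. 293, §1 pp. 263–264.
-/

noncomputable section

open scoped Matrix.Norms.L2Operator

namespace Summit.QuantumFields.YangMills.Theorems.K1V10Defs

open Literature.MathematicalPhysics.QuantumFieldTheory.Balaban1983to89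
open Literature.MathematicalPhysics.QuantumFieldTheory.Balaban1983to89.T4Continuum
open Literature.MathematicalPhysics.QuantumFieldTheory.Balaban1983to89.DagBinding
open FlowStepRuns
open FlowStep (HBeta RGEqH prefixOf)
open Summit.QuantumFields.YangMills.Theorems.BalabanUVNodesK2NamedJetsRunRemAt (RunRemAt RunConstRemainder SurvCont)
open Summit.QuantumFields.YangMills.Theorems.K1V6Defs (RecordS Inhabited13 NodesAtSomeRecord13PWS RunRowsAtSomeRecord13PWS Window)
open Summit.QuantumFields.YangMills.Theorems.K1V7RDefs (RunRowsContAtSomeRecord13PWS)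
open Summit.QuantumFields.YangMills.Theorems.K1V9Defs
open Summit.QuantumFields.YangMills.Theorems.BalabanUVNodesK1R8RowsDefs (RunRowsCont13 runRowsCont13_intro)

/-! ## §1 The v10 LINE-2′ predicate texts, verbatim -/

/-- **rung 1ⱽᵂ (LINE 2′; v10 VERBATIM (= R1W draft :447) = the CONCLUSION of `stub_nodes13PWSVW`, the HYPOTHESIS of `stub_runRows13PWSVW`)**: LINE 2's rung 1ⱽ (`K1V9Defs.NodesAtSomeRecord13PWSV`) with the
thirteen nodes AND the [IV]-pin asked only on runs inside the world's coupling window `(leavesP w P).smallCouplings` (dag-n24-c g11 LOCATED-RUNG1-PIN option (α)); every other conjunct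
byte-identical. (Locators, context only: Balaban1989LargeFieldII, Thm 1 p.355 + (0.1) pp.355–356; Balaban1989LargeFieldI, (1.2) p.178, Prop. 1 p.194 (statement shapes).) HYPOTHESIS SHAPE, never a fact. [folklore] -/
def NodesAtSomeRecord13PWSVW (F : T4Family) : Prop :=
  ∃ (θ : Node00.Stage13HParams F 2) (h : θ.Provisos₁₃SepCoPH F 2) (v : Node00.Revision₁₃ F 2 θ h) (w : WorldP), (θ.ZhUnity F 2 ∧ θ.SlotsNondegenerate₁₃ F 2) ∧ θ.Admissible F 2 ∧
    RecordSV F θ h v w ∧ (∀ P : B12.RunParams, (leavesP w P).smallCouplings → Nodes (leavesP w P)) ∧ Node00.PrintedUV3V 2 θ.L ∧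
    ∃ lam : Node00.ResidW F 2, (∀ P : B12.RunParams, 1 ≤ P.K → lam.kSel P < P.K) ∧
      ∀ P : B12.RunParams, lam.kSel P < P.K → (leavesP w P).smallCouplings → ((leavesP w P).rBasicStep ↔ B15Leaf (Node00.WOfRecord₁₃ F 2 θ.toStage13Params lam P))

/-- **rung 2ⱽᵂ (LINE 2′; v10 VERBATIM (= R1W draft :454) = the CONCLUSION of `stub_runRows13PWSVW`, the HYPOTHESIS of `stub_cont13VW`)**: rung 2ⱽ with the nodes window-guarded; the run rows (i)–(iv)
unchanged (θ-level). (Locators, context only: Balaban1987RG1, Thm 3 p.264, (1.22) p.264, (5.10) p.293 (statement shapes).) HYPOTHESIS SHAPE, never a fact. [folklore] -/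
def RunRowsAtSomeRecord13PWSVW (F : T4Family) : Prop :=
  ∃ (θ : Node00.Stage13HParams F 2) (h : θ.Provisos₁₃SepCoPH F 2) (v : Node00.Revision₁₃ F 2 θ h) (w : WorldP), (θ.ZhUnity F 2 ∧ θ.SlotsNondegenerate₁₃ F 2) ∧ θ.Admissible F 2 ∧
    RecordSV F θ h v w ∧ (∀ P : B12.RunParams, (leavesP w P).smallCouplings → Nodes (leavesP w P)) ∧
    ∃ (b : ℕ → ℝ) (r γ₀ B M : ℝ), 0 < γ₀ ∧ RunConstRemainder (Node00.betaOfRecord₁₃ F 2 θ.toStage13Params) b r γ₀ ∧ (∀ k, b k ≤ B) ∧ B + r ≤ w.βup ∧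
      ∀ (n : ℕ) (gs : ℕ → ℝ), RGEqH n (Node00.betaOfRecord₁₃ F 2 θ.toStage13Params) gs → Step.InInterval γ₀ n gs →
        ∀ k, k ≤ n → -M ≤ ∑ j ∈ Finset.Ico k n, Node00.betaOfRecord₁₃ F 2 θ.toStage13Params j (prefixOf gs j)

/-- **rung 2ⱽᵂ‴ (LINE 2′; v10 VERBATIM (= R1W draft :462) = the CONCLUSION of `stub_cont13VW`)**: rung 2ⱽ‴ with the nodes window-guarded; rows + (C) unchanged.
(Locators, context only: Balaban1987RG1, §1 pp.263–264 (statement shape only).) HYPOTHESIS SHAPE, never a fact. [folklore] -/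
def RunRowsContAtSomeRecord13PWSVW (F : T4Family) : Prop :=
  ∃ (θ : Node00.Stage13HParams F 2) (h : θ.Provisos₁₃SepCoPH F 2) (v : Node00.Revision₁₃ F 2 θ h) (w : WorldP), (θ.ZhUnity F 2 ∧ θ.SlotsNondegenerate₁₃ F 2) ∧ θ.Admissible F 2 ∧
    RecordSV F θ h v w ∧ (∀ P : B12.RunParams, (leavesP w P).smallCouplings → Nodes (leavesP w P)) ∧
    ∃ (b : ℕ → ℝ) (r γ₀ B M : ℝ), 0 < γ₀ ∧ RunConstRemainder (Node00.betaOfRecord₁₃ F 2 θ.toStage13Params) b r γ₀ ∧ (∀ k, b k ≤ B) ∧ B + r ≤ w.βup ∧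
      (∀ (n : ℕ) (gs : ℕ → ℝ), RGEqH n (Node00.betaOfRecord₁₃ F 2 θ.toStage13Params) gs → Step.InInterval γ₀ n gs →
        ∀ k, k ≤ n → -M ≤ ∑ j ∈ Finset.Ico k n, Node00.betaOfRecord₁₃ F 2 θ.toStage13Params j (prefixOf gs j)) ∧
      SurvCont (Node00.betaOfRecord₁₃ F 2 θ.toStage13Params) γ₀

/-! ## §2 Doors LINE 2 ⟹ LINE 2′ (drop the nodes ∕ the pin outside the window) and LINE 1 ⟹ LINE 2′ -/

/-- LINE 2 ⟹ LINE 2′ at rung 1 (draft :471; kernel): every LINE-2 (hence every LINE-1) rung-1 result feeds LINE 2′. [cite: Balaban1989LargeFieldII, Thm 1 p.355 (bookkeeping)] -/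
theorem nodesAtSomeRecord13PWSVW_of_V {F : T4Family} (hN : NodesAtSomeRecord13PWSV F) : NodesAtSomeRecord13PWSVW F := by
  obtain ⟨θ, h, v, w, hU, hθ, hR, hnodes, h08, lam, hsel, hstep⟩ := hN
  exact ⟨θ, h, v, w, hU, hθ, hR, fun P _ => hnodes P, h08, lam, hsel, fun P hk _ => hstep P hk⟩

/-- LINE 2 ⟹ LINE 2′ at rung 2 (draft :476). [cite: Balaban1987RG1, Thm 3 p.264 (bookkeeping)] -/
theorem runRowsAtSomeRecord13PWSVW_of_V {F : T4Family} (hN : RunRowsAtSomeRecord13PWSV F) : RunRowsAtSomeRecord13PWSVW F := by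
  obtain ⟨θ, h, v, w, hU, hθ, hR, hnodes, b, r, γ₀, B, M, hγ₀, hrem, hB, hmatch, hps⟩ := hN
  exact ⟨θ, h, v, w, hU, hθ, hR, fun P _ => hnodes P, b, r, γ₀, B, M, hγ₀, hrem, hB, hmatch, hps⟩

/-- LINE 2 ⟹ LINE 2′ at rung 2‴ (draft :481). [cite: Balaban1987RG1, §1 pp.263–264 (bookkeeping)] -/
theorem runRowsContAtSomeRecord13PWSVW_of_V {F : T4Family} (hN : RunRowsContAtSomeRecord13PWSV F) : RunRowsContAtSomeRecord13PWSVW F := by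
  obtain ⟨θ, h, v, w, hU, hθ, hR, hnodes, b, r, γ₀, B, M, hγ₀, hrem, hB, hmatch, hps, hsc⟩ := hN
  exact ⟨θ, h, v, w, hU, hθ, hR, fun P _ => hnodes P, b, r, γ₀, B, M, hγ₀, hrem, hB, hmatch, hps, hsc⟩

/-- LINE 1 ⟹ LINE 2′ at rung 1 (the `refl` door `K1V9Defs.nodesAtSomeRecord13PWSV_of_line1`, then the window door). [cite: Balaban1989LargeFieldII, Thm 1 p.355 (bookkeeping)] -/
theorem nodesAtSomeRecord13PWSVW_of_line1 {F : T4Family} (hN : NodesAtSomeRecord13PWS F) : NodesAtSomeRecord13PWSVW F :=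
  nodesAtSomeRecord13PWSVW_of_V (nodesAtSomeRecord13PWSV_of_line1 hN)

/-- LINE 1 ⟹ LINE 2′ at rung 2‴. [cite: Balaban1987RG1, §1 pp.263–264 (bookkeeping)] -/
theorem runRowsContAtSomeRecord13PWSVW_of_line1 {F : T4Family} (hN : RunRowsContAtSomeRecord13PWS F) : RunRowsContAtSomeRecord13PWSVW F :=
  runRowsContAtSomeRecord13PWSVW_of_V (runRowsContAtSomeRecord13PWSV_of_line1 hN)

/-! ## §3 Rung projections -/

/-- rung 2ⱽᵂ‴ ⟹ rung 2ⱽᵂ (drop (C)). [cite: Balaban1987RG1, Thm 3 p.264 (bookkeeping)] -/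
theorem runRowsAtSomeRecord13PWSVW_of_runRowsContAtSomeRecord13PWSVW (F : T4Family) (h : RunRowsContAtSomeRecord13PWSVW F) : RunRowsAtSomeRecord13PWSVW F := by
  obtain ⟨θ, hP, v, w, hU, hθ, hR, hnodes, b, r, γ₀, B, M, hγ₀, hrem, hB, hmatch, hps, -⟩ := h
  exact ⟨θ, hP, v, w, hU, hθ, hR, hnodes, b, r, γ₀, B, M, hγ₀, hrem, hB, hmatch, hps⟩

/-- rung 2ⱽᵂ ⟹ «an `RecordSⱽ` world with the thirteen nodes on every IN-WINDOW run» — the W-END road's input. [folklore] -/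
theorem exists_recordSV_nodesW_of_runRowsAtSomeRecord13PWSVW (F : T4Family) (h : RunRowsAtSomeRecord13PWSVW F) :
    ∃ (θ : Node00.Stage13HParams F 2) (h : θ.Provisos₁₃SepCoPH F 2) (v : Node00.Revision₁₃ F 2 θ h) (w : WorldP), (θ.ZhUnity F 2 ∧ θ.SlotsNondegenerate₁₃ F 2) ∧ θ.Admissible F 2 ∧
      RecordSV F θ h v w ∧ (∀ P : B12.RunParams, (leavesP w P).smallCouplings → Nodes (leavesP w P)) := by
  obtain ⟨θ, hP, v, w, hU, hθ, hR, hnodes, -⟩ := h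
  exact ⟨θ, hP, v, w, hU, hθ, hR, hnodes⟩

/-- **rung 2ⱽᵂ‴ ⟹ DEF-1's PER-TUPLE ROWS `RunRowsCont13 F θ` (guard-free, θ-level — K1⁹'s OWN rows conjunct) AT THE WITNESS** with the guarded rung-1ⱽᵂ data there: ONLY the (B)+window half of a
composition reads the guard. [cite: Balaban1987RG1, Thm 3 p.264, §1 pp.263–264 (bookkeeping)] -/
theorem exists_runRowsCont13_of_runRowsContAtSomeRecord13PWSVW (F : T4Family) (h : RunRowsContAtSomeRecord13PWSVW F) :
    ∃ (θ : Node00.Stage13HParams F 2) (h : θ.Provisos₁₃SepCoPH F 2) (v : Node00.Revision₁₃ F 2 θ h) (w : WorldP), (θ.ZhUnity F 2 ∧ θ.SlotsNondegenerate₁₃ F 2) ∧ θ.Admissible F 2 ∧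
      RecordSV F θ h v w ∧ (∀ P : B12.RunParams, (leavesP w P).smallCouplings → Nodes (leavesP w P)) ∧ RunRowsCont13 F θ := by
  obtain ⟨θ, hP, v, w, hU, hθ, hR, hnodes, b, r, γ₀, B, M, hγ₀, hrem, -, -, hps, hsc⟩ := h
  exact ⟨θ, hP, v, w, hU, hθ, hR, hnodes, runRowsCont13_intro θ hγ₀ hrem hps hsc⟩

end Summit.QuantumFields.YangMills.Theorems.K1V10Defs

end
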